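import Literature.Geometry.Riemannian.BishopGromovRelativeVolume
import HarnessLib

/-!
# Directionally restricted and annular relative volume comparison: (A.2.2) of Cheeger–Colding 1997

Cheeger–Colding, *On the structure of spaces with Ricci curvature bounded below. I*,
J. Differential Geom. 46 (1997), Appendix 2, isolate as the synthetic form of "mean curvature
comparison" under `Ric ≥ (n-1)H` the DIRECTIONALLY RESTRICTED RELATIVE VOLUME COMPARISON (A.2.2)
(p. 473): for `p ∈ X`, `0 < s₁ < s₂ < r₁ < r₂` and an open subset `U` of the annulus
`A_{r₁,r₂}(p) = B_{r₂}(p) ∖ B_{r₁}(p)`,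

  `(V_{n,H}(s₂) - V_{n,H}(s₁)) / ν(S_{s₁,s₂}(p, U)) ≤ (V_{n,H}(r₂) - V_{n,H}(r₁)) / ν(U)`,

where (A.2.1) `S_{s₁,s₂}(p, U) = {x ∈ A_{s₁,s₂}(p) | d(p,x) + d(x,z) = d(p,z) for some z ∈ U}` is the
intersection with `A_{s₁,s₂}(p)` of the angular sector of minimal geodesics from `p` ending in `U`
("compare (0.5)"; "at least formally, (A.2.2) implies Theorem 2.11 of [15]", the segment
inequality). This file PROVES (A.2.2) for smooth connected Riemannian `d`-manifolds with
geodesically complete Levi-Civita connection and `Ric ≥ -(d-1) g` (`H = -1`, the normalisation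
(1.1) of the paper and of the named fact `CheegerColding1997_sphereStability` of
`VolumeSphereTheoremGHDecomposition.lean`, whose seat writes this file):
`riemannianMeasure_inter_annulus_mul_le_sector_of_ricci_ge_neg`, together with the plain annular
relative volume comparison `Vol A_{r₁,r₂}(p)/Vol A_{s₁,s₂}(p) ≤ (V(r₂)-V(r₁))/(V(s₂)-V(s₁))`
(Zhu 1997, Thm. 3.1; `riemannianMeasure_annulus_mul_le_of_ricci_ge_neg`), both in cross-multiplied
form with `V(b) - V(a) = ∫ₐᵇ sinh^{d-1}` (the constant `|S^{d-1}|` cancelling) and for all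
`0 ≤ s₁ ≤ s₂ ≤ r₁ ≤ r₂`.

## The proof (continuing `BishopGromovRelativeVolume.lean`)

* §1 `setLIntegral_Ico_mul_setLIntegral_Ioc_le` — the two-interval Gromov lemma (Zhu 1997,
  Lemma 3.2) for `[0,∞]`-valued functions: `φ(t)γ(u) ≤ φ(u)γ(t)` for `u ≤ t` gives
  `(∫_{[r₁,r₂)} φ)(∫_{(s₁,s₂]} γ) ≤ (∫_{(s₁,s₂]} φ)(∫_{[r₁,r₂)} γ)`; the model annular volumes.
* §2 `expPolar_data` — exponential polar coordinates at `p` recorded once: for a `g_p`-isometry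
  `L : ℝᵈ ≅ T_pM`, `F = exp_p ∘ L` is injective on the open star-shaped `W = L⁻¹ ID(p)` with the
  area formula `Vol(F A) = ∫_A 𝒥` (`A ⊆ W` Borel), a Lebesgue-null Borel `N` with `Vol(F N) = 0`
  such that every point is `F x` with `|x| = d(p, ·)`, `γ_{Lx}` minimizing and `x ∈ W ∪ N`
  (Hopf–Rinow, cut vectors), and `d(F(sx), F(tx)) = |s - t||x|` on `W` (minimal segments) —
  the ingredients of `riemannianMeasure_ball_eq_setLIntegral_indicator`, exposed for reuse.
* §3 `indicator_jacobian_mul_sinh_pow_le` — Bishop's monotonicity (III.4.12) for the polar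
  density `𝟙_W 𝒥` against `sinh^{d-1}` along every ray (from
  `sqrt_det_gram_expMap_ray_mul_sinh_pow_le`, `W` star-shaped); radial sections of shells.
* §4 The annular theorem: the outer annulus is covered by `F(W ∩ {r₁ ≤ |x| < r₂}) ∪ F(N)`, the
  image of `W ∩ {s₁ < |x| ≤ s₂}` lies in the inner annulus, and §1 + §3 on each ray.
* §5 (A.2.2): with `E_U = {r₁ ≤ |x| < r₂} ∩ F⁻¹U` and the OPEN cone
  `H = {x | ∃ τ > 1, τx ∈ W ∩ F⁻¹U, r₁ < |τx| < r₂}`, the image of `W ∩ {s₁ < |x| ≤ s₂} ∩ H`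
  lies in the sector `S_{s₁,s₂}(p, U)` (sub-segments of minimal segments,
  `edist_expMap_smul_of_isMinimizingUpTo`); a ray meeting `W ∩ E_U` in a set of positive length
  meets it at a radius `t₀ ∈ (r₁, r₂)`, whence its segment over `(s₁, s₂]` lies in that cone, and
  §1 + §3 apply ray by ray; openness of `U` (as in the paper) makes `H` open, hence Borel.

No definitions and no named facts are introduced (D-0026).

## References

* J. Cheeger, T. H. Colding, *On the structure of spaces with Ricci curvature bounded below. I*,
  J. Differential Geom. 46 (1997) 406–480: Appendix 2, (A.2.1)–(A.2.2) (p. 473); (0.5) (p. 410).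
  [CheegerColding1997]
* S. Zhu, *The comparison geometry of Ricci curvature*, in: Comparison Geometry, MSRI Publ. 30
  (1997) 221–262, Thm. 3.1 and Lemma 3.2 (p. 226). [Zhu1997]
* I. Chavel, *Riemannian Geometry: A Modern Introduction*, 2nd ed., CUP 2006, §III.3–III.4
  (Prop. III.4.1, Thm. III.4.3, Thm. III.4.5). [Chavel2006]
* J. M. Lee, *Introduction to Riemannian Manifolds*, 2nd ed., Springer GTM 176, 2018, Cor. 6.21,
  Prop. 10.32, Thm. 10.34. [LeeRiemannianManifolds2018]
-/

noncomputable section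

open Bundle Set Function Filter MeasureTheory Manifold
open scoped Manifold ContDiff Topology ENNReal NNReal

namespace Literature.Geometry.Riemannian

open Lorentzian Lorentzian.PseudoRiemannianMetric

/-! ### §1. The two-parameter Gromov lemma in `ℝ≥0∞` -/

section Gromov

/-- **Gromov's lemma for two intervals** (Zhu 1997, Lemma 3.2; Chavel 2006, Lemma III.4.1; the
one-variable content of (A.2.2) of Cheeger–Colding 1997), for `[0, ∞]`-valued measurable
functions in cross-multiplied form: if `φ(t) γ(u) ≤ φ(u) γ(t)` whenever `0 < u ≤ t < r₂`, then
for `0 ≤ s₁`, `s₂ ≤ r₁`: `(∫_{[r₁,r₂)} φ)(∫_{(s₁,s₂]} γ) ≤ (∫_{(s₁,s₂]} φ)(∫_{[r₁,r₂)} γ)`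
(integrate the hypothesis over `u ∈ (s₁, s₂]`, `t ∈ [r₁, r₂)`).
[cite: Zhu1997, Lemma 3.2 (p. 226)] [cite: CheegerColding1997, (A.2.2) (p. 473)] -/
theorem setLIntegral_Ico_mul_setLIntegral_Ioc_le {φ γ : ℝ → ℝ≥0∞} (hφ : Measurable φ)
    (hγ : Measurable γ) {s₁ s₂ r₁ r₂ : ℝ} (hs₁ : 0 ≤ s₁) (hsr : s₂ ≤ r₁)
    (h : ∀ u t : ℝ, 0 < u → u ≤ t → t < r₂ → φ t * γ u ≤ φ u * γ t) :
    (∫⁻ t in Ico r₁ r₂, φ t) * (∫⁻ t in Ioc s₁ s₂, γ t) ≤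
      (∫⁻ t in Ioc s₁ s₂, φ t) * (∫⁻ t in Ico r₁ r₂, γ t) := by
  calc (∫⁻ t in Ico r₁ r₂, φ t) * (∫⁻ u in Ioc s₁ s₂, γ u)
      = ∫⁻ t in Ico r₁ r₂, φ t * ∫⁻ u in Ioc s₁ s₂, γ u := by rw [lintegral_mul_const _ hφ]
    _ = ∫⁻ t in Ico r₁ r₂, ∫⁻ u in Ioc s₁ s₂, φ t * γ u := by
        refine setLIntegral_congr_fun measurableSet_Ico fun t _ ↦ ?_
        rw [lintegral_const_mul _ hγ]
    _ ≤ ∫⁻ t in Ico r₁ r₂, ∫⁻ u in Ioc s₁ s₂, φ u * γ t := by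
        refine lintegral_mono_ae (ae_restrict_of_forall_mem measurableSet_Ico fun t ht ↦ ?_)
        refine lintegral_mono_ae (ae_restrict_of_forall_mem measurableSet_Ioc fun u hu ↦ ?_)
        exact h u t (hs₁.trans_lt hu.1) (hu.2.trans (hsr.trans ht.1)) ht.2
    _ = ∫⁻ t in Ico r₁ r₂, (∫⁻ u in Ioc s₁ s₂, φ u) * γ t := by
        refine setLIntegral_congr_fun measurableSet_Ico fun t _ ↦ ?_
        rw [lintegral_mul_const _ hφ]
    _ = (∫⁻ u in Ioc s₁ s₂, φ u) * ∫⁻ t in Ico r₁ r₂, γ t := by rw [lintegral_const_mul _ hγ]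

/-- The hyperbolic model volume of an annulus as a Lebesgue integral: for `0 ≤ a ≤ b`,
`∫_{[a,b)} sinh^k = ∫_{(a,b]} sinh^k = ENNReal.ofReal (∫ₐᵇ sinh^k)`. [folklore] -/
theorem setLIntegral_Ico_sinh_pow_eq_ofReal (k : ℕ) {a b : ℝ} (ha : 0 ≤ a) (hab : a ≤ b) :
    ∫⁻ t in Ico a b, ENNReal.ofReal (Real.sinh t ^ k) =
      ENNReal.ofReal (∫ t in a..b, Real.sinh t ^ k) := by
  rw [Measure.restrict_congr_set Ico_ae_eq_Ioc, intervalIntegral.integral_of_le hab,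
    ← ofReal_integral_eq_lintegral_ofReal]
  · exact (Real.continuous_sinh.pow k).integrableOn_Ioc
  · exact ae_restrict_of_forall_mem measurableSet_Ioc fun t ht ↦
      pow_nonneg (Real.sinh_nonneg_iff.2 (ha.trans ht.1.le)) _

/-- As `setLIntegral_Ico_sinh_pow_eq_ofReal`, over `(a, b]`. [folklore] -/
theorem setLIntegral_Ioc_sinh_pow_eq_ofReal (k : ℕ) {a b : ℝ} (ha : 0 ≤ a) (hab : a ≤ b) :
    ∫⁻ t in Ioc a b, ENNReal.ofReal (Real.sinh t ^ k) =
      ENNReal.ofReal (∫ t in a..b, Real.sinh t ^ k) := by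
  rw [intervalIntegral.integral_of_le hab, ← ofReal_integral_eq_lintegral_ofReal]
  · exact (Real.continuous_sinh.pow k).integrableOn_Ioc
  · exact ae_restrict_of_forall_mem measurableSet_Ioc fun t ht ↦
      pow_nonneg (Real.sinh_nonneg_iff.2 (ha.trans ht.1.le)) _

end Gromov

/-! ### §2. Exponential polar coordinates at a point: the data, once and for all -/

section PolarData

variable {d : ℕ} {M : Type*} [TopologicalSpace M] [ChartedSpace (EuclideanSpace ℝ (Fin d)) M]
  [IsManifold 𝓘(ℝ, EuclideanSpace ℝ (Fin d)) ∞ M] [T2Space M]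
  (g : PseudoRiemannianMetric 𝓘(ℝ, EuclideanSpace ℝ (Fin d)) ∞ (EuclideanSpace ℝ (Fin d))
    (TangentSpace 𝓘(ℝ, EuclideanSpace ℝ (Fin d)) : M → Type _)) [g.HasLeviCivita]
  [CovariantDerivative.ContMDiffCovariantDerivative g.leviCivita 1]
  [CovariantDerivative.ContMDiffCovariantDerivative g.leviCivita ∞]

/-- **Exponential polar coordinates at `p`** (Chavel 2006, §III.3; Lee 2018, Thm. 10.34 and
Cor. 6.21): for a `g_p`-linear isometry `L : ℝᵈ ≅ T_pM`, the map `F = exp_p ∘ L`, the open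
star-shaped set `W = L⁻¹ ID(p)` and the Gram–Jacobian `𝒥` of `F`, we record: `F` is injective on
`W`; the area formula `Vol(F A) = ∫_A 𝒥` for Borel `A ⊆ W`
(`riemannianMeasure_image_eq_lintegral_of_injOn`); a Lebesgue-null Borel set `N` with
`Vol(F N) = 0` such that every `y ∈ M` is `F x` with `|x| = d(p, y)`, `γ_{Lx}|[0,1]` minimizing
and `x ∈ W ∪ N` (Hopf–Rinow and the null set of cut vectors met by each ray at most once); and
the metric behaviour of `F` on `W`: `d(F(s x), F(t x)) = |s - t| |x|` for `x ∈ W`,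
`s, t ∈ [0, 1]` (minimal segments). [cite: Chavel2006, §III.3]
[cite: LeeRiemannianManifolds2018, Thm. 10.34 and Cor. 6.21] -/
theorem expPolar_data (hd : 0 < d) [ConnectedSpace M] [T3Space M] [MeasurableSpace M]
    [BorelSpace M] (hg : g.IsRiemannian) (hc : IsGeodesicallyComplete g.leviCivita) (p : M)
    (L : (EuclideanSpace ℝ (Fin d)) ≃L[ℝ] (EuclideanSpace ℝ (Fin d)))
    (hL : ∀ x y : (EuclideanSpace ℝ (Fin d)), g.val p (L x) (L y) = inner ℝ x y) :
    InjOn (fun x : (EuclideanSpace ℝ (Fin d)) ↦ expMap g.leviCivita p (L x))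
        {x : EuclideanSpace ℝ (Fin d) |
          (show TangentSpace 𝓘(ℝ, (EuclideanSpace ℝ (Fin d))) p from L x) ∈
            injectivityDomain g hg p} ∧
      (∀ A : Set (EuclideanSpace ℝ (Fin d)), MeasurableSet A →
        A ⊆ {x : EuclideanSpace ℝ (Fin d) |
          (show TangentSpace 𝓘(ℝ, (EuclideanSpace ℝ (Fin d))) p from L x) ∈
            injectivityDomain g hg p} →
        riemannianMeasure (I := 𝓘(ℝ, (EuclideanSpace ℝ (Fin d))))
            (g.toContMDiffRiemannianMetric hg)
            ((fun x : (EuclideanSpace ℝ (Fin d)) ↦ expMap g.leviCivita p (L x)) '' A) =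
          ∫⁻ z in A, ENNReal.ofReal (Real.sqrt (Matrix.of fun i j : Fin d ↦
            g.val (expMap g.leviCivita p (L z))
              (mfderiv 𝓘(ℝ, (EuclideanSpace ℝ (Fin d))) 𝓘(ℝ, (EuclideanSpace ℝ (Fin d)))
                (fun x : (EuclideanSpace ℝ (Fin d)) ↦ expMap g.leviCivita p (L x)) z
                (EuclideanSpace.single i 1))
              (mfderiv 𝓘(ℝ, (EuclideanSpace ℝ (Fin d))) 𝓘(ℝ, (EuclideanSpace ℝ (Fin d)))
                (fun x : (EuclideanSpace ℝ (Fin d)) ↦ expMap g.leviCivita p (L x)) z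
                (EuclideanSpace.single j 1))).det)) ∧
      (∃ N : Set (EuclideanSpace ℝ (Fin d)), MeasurableSet N ∧ volume N = 0 ∧
        riemannianMeasure (I := 𝓘(ℝ, (EuclideanSpace ℝ (Fin d))))
            (g.toContMDiffRiemannianMetric hg)
            ((fun x : (EuclideanSpace ℝ (Fin d)) ↦ expMap g.leviCivita p (L x)) '' N) = 0 ∧
        ∀ y : M, ∃ x : EuclideanSpace ℝ (Fin d), expMap g.leviCivita p (L x) = y ∧
          ENNReal.ofReal ‖x‖ = g.edist hg p y ∧
          IsMinimizingUpTo g hg p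
            (show TangentSpace 𝓘(ℝ, (EuclideanSpace ℝ (Fin d))) p from L x) 1 ∧
          (x ∈ {x : EuclideanSpace ℝ (Fin d) |
            (show TangentSpace 𝓘(ℝ, (EuclideanSpace ℝ (Fin d))) p from L x) ∈
              injectivityDomain g hg p} ∨ x ∈ N)) ∧
      (∀ x ∈ {x : EuclideanSpace ℝ (Fin d) |
          (show TangentSpace 𝓘(ℝ, (EuclideanSpace ℝ (Fin d))) p from L x) ∈
            injectivityDomain g hg p},
        g.edist hg p (expMap g.leviCivita p (L x)) = ENNReal.ofReal ‖x‖ ∧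
        ∀ s ∈ Icc (0 : ℝ) 1, ∀ t ∈ Icc (0 : ℝ) 1,
          g.edist hg (expMap g.leviCivita p (L (s • x))) (expMap g.leviCivita p (L (t • x))) =
            ENNReal.ofReal (|s - t| * ‖x‖)) := by
  classical
  haveI : Nontrivial (EuclideanSpace ℝ (Fin d)) := by
    have : 0 < Module.finrank ℝ (EuclideanSpace ℝ (Fin d)) := by
      rw [finrank_euclideanSpace_fin]; exact hd
    exact Module.finrank_pos_iff.1 this
  haveI : Fact ((1 : ℕ∞ω) ≤ ((⊤ : ℕ∞) : ℕ∞ω)) := ⟨by exact_mod_cast le_top⟩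
  set h := g.toContMDiffRiemannianMetric hg with hh_def
  set vol : Measure M := riemannianMeasure (I := 𝓘(ℝ, (EuclideanSpace ℝ (Fin d)))) h with hvol
  set Φ : (EuclideanSpace ℝ (Fin d)) → M := fun x ↦ expMap g.leviCivita p (L x) with hΦ_def
  have hΦs : ContMDiff 𝓘(ℝ, (EuclideanSpace ℝ (Fin d))) 𝓘(ℝ, (EuclideanSpace ℝ (Fin d))) 1 Φ :=
    ((contMDiff_expMap_infty hc p).of_le (by exact_mod_cast le_top)).comp
      L.toContinuousLinearMap.contDiff.contMDiff
  have hΦd : ∀ z : (EuclideanSpace ℝ (Fin d)), MDifferentiableAt 𝓘(ℝ, (EuclideanSpace ℝ (Fin d)))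
      𝓘(ℝ, (EuclideanSpace ℝ (Fin d))) Φ z := fun z ↦
    (hΦs z).mdifferentiableAt one_ne_zero
  set W : Set (EuclideanSpace ℝ (Fin d)) := {x | (show TangentSpace 𝓘(ℝ, (EuclideanSpace ℝ (Fin d))) p
    from L x) ∈ injectivityDomain g hg p} with hW_def
  have hWo : IsOpen W :=
    (isOpen_injectivityDomain_of_isGeodesicallyComplete g le_rfl hg hc p).preimage L.continuous
  have hstar : ∀ x ∈ W, ∀ s : ℝ, 0 < s → s ≤ 1 → s • x ∈ W := by
    intro x hx s hs0 hs1
    show (show TangentSpace 𝓘(ℝ, (EuclideanSpace ℝ (Fin d))) p from L (s • x)) ∈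
      injectivityDomain g hg p
    rw [map_smul]
    exact smul_mem_injectivityDomain hg hc hx hs0.le hs1
  have hinj : InjOn Φ W := by
    intro x hx y hy hxy
    have := injOn_riemannianExpMap_injectivityDomain g le_rfl hg hc p hx hy hxy
    exact L.injective this
  have hnorm : ∀ x : (EuclideanSpace ℝ (Fin d)), Real.sqrt (g.val p (L x) (L x)) = ‖x‖ := fun x ↦ by
    rw [hL x x, ← norm_eq_sqrt_real_inner]
  refine ⟨hinj, fun A hA hAW ↦ ?_, ?_, ?_⟩
  · -- the area formula
    exact riemannianMeasure_image_eq_lintegral_of_injOn h hWo (fun z _ ↦ hΦd z) hinj hA hAW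
  · -- the null set of cut vectors and the polar representation of points
    set N : Set (EuclideanSpace ℝ (Fin d)) := Wᶜ ∩ ⋂ m : ℕ,
      (fun x : (EuclideanSpace ℝ (Fin d)) ↦ (1 - 1 / ((m : ℝ) + 2)) • x) ⁻¹' W with hN_def
    have hNm : MeasurableSet N := measurableSet_compl_inter_iInter_preimage_smul hWo
    have hN0 : volume N = 0 :=
      volume_eq_zero_of_subsingleton_ray hd hNm fun θ _ ↦ subsingleton_ray_of_star hstar θ
    have hΦN : vol (Φ '' N) = 0 :=
      riemannianMeasure_image_eq_zero_of_volume_eq_zero h isOpen_univ (fun z _ ↦ hΦd z)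
        (subset_univ N) hN0
    refine ⟨N, hNm, hN0, hΦN, fun y ↦ ?_⟩
    obtain ⟨v, hmin, hvy, hdist⟩ := exists_isMinimizingUpTo_expMap_eq g le_rfl hg hc p y
    set x : (EuclideanSpace ℝ (Fin d)) := L.symm v with hx_def
    have hLx : (L x : (EuclideanSpace ℝ (Fin d))) = v := L.apply_symm_apply v
    refine ⟨x, ?_, ?_, ?_, ?_⟩
    · show expMap g.leviCivita p (L x) = y
      rw [hLx]; exact hvy
    · rw [hdist, ← hnorm x, hLx]
    · show IsMinimizingUpTo g hg p (show TangentSpace 𝓘(ℝ, (EuclideanSpace ℝ (Fin d))) p from L x) 1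
      rw [hLx]; exact hmin
    · by_cases hxW : x ∈ W
      · exact Or.inl hxW
      · refine Or.inr ⟨hxW, mem_iInter.2 fun m ↦ ?_⟩
        have hm2 : (0 : ℝ) < (m : ℝ) + 2 := by positivity
        have hc0 : (0 : ℝ) < 1 - 1 / ((m : ℝ) + 2) := by
          rw [sub_pos, div_lt_one hm2]; linarith
        have hc1 : 1 - 1 / ((m : ℝ) + 2) < 1 := by
          have : (0 : ℝ) < 1 / ((m : ℝ) + 2) := by positivity
          linarith
        show (show TangentSpace 𝓘(ℝ, (EuclideanSpace ℝ (Fin d))) p from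
          L ((1 - 1 / ((m : ℝ) + 2)) • x)) ∈ injectivityDomain g hg p
        rw [map_smul, hLx]
        exact smul_mem_injectivityDomain_of_isMinimizingUpTo_one_of_lt g hg hc p hmin hc0 hc1
  · -- minimal segments inside `W`
    intro x hxW
    obtain ⟨s', hs'1, hmin⟩ := hxW
    have hmin1 : IsMinimizingUpTo g hg p
        (show TangentSpace 𝓘(ℝ, (EuclideanSpace ℝ (Fin d))) p from L x) 1 :=
      hmin.mono hc zero_le_one hs'1.le
    have h2 := edist_eq_of_isMinimizingUpTo hg hc hmin1
    refine ⟨by rw [← hnorm x]; exact h2, fun s hs t ht ↦ ?_⟩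
    have h1 := edist_expMap_smul_of_isMinimizingUpTo hg hc hmin1 s hs t ht
    rw [h2, hnorm x, ← ENNReal.ofReal_mul (abs_nonneg _)] at h1
    rw [map_smul, map_smul]
    exact h1

end PolarData

/-! ### §3. The radial comparison of the polar density `𝟙_W 𝒥` against `sinh^{d-1}` -/

section Radial

variable {d : ℕ} {M : Type*} [TopologicalSpace M] [ChartedSpace (EuclideanSpace ℝ (Fin d)) M]
  [IsManifold 𝓘(ℝ, EuclideanSpace ℝ (Fin d)) ∞ M] [T2Space M]
  (g : PseudoRiemannianMetric 𝓘(ℝ, EuclideanSpace ℝ (Fin d)) ∞ (EuclideanSpace ℝ (Fin d))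
    (TangentSpace 𝓘(ℝ, EuclideanSpace ℝ (Fin d)) : M → Type _)) [g.HasLeviCivita]
  [CovariantDerivative.ContMDiffCovariantDerivative g.leviCivita 1]
  [CovariantDerivative.ContMDiffCovariantDerivative g.leviCivita ∞]

/-- **Bishop's monotonicity (III.4.12) for the polar density of `exp_p`, `Ric ≥ -(d-1)`**
(Chavel 2006, Thm. III.4.3 and Prop. III.4.1, `κ = -1`; the per-direction input of (0.5) and
(A.2.2) of Cheeger–Colding 1997): in exponential polar coordinates `F = exp_p ∘ L` at `p`, the
density `Ψ = 𝟙_W 𝒥` (`W = L⁻¹ ID(p)`) satisfies along every ray, for `0 < u ≤ t`,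
`Ψ(tθ) t^{d-1} sinh^{d-1}(u) ≤ Ψ(uθ) u^{d-1} sinh^{d-1}(t)`: inside `W` this is
`sqrt_det_gram_expMap_ray_mul_sinh_pow_le` (no conjugate point before the cut point), and `W` is
star-shaped. [cite: Chavel2006, §III.4, Thm. III.4.3 and Prop. III.4.1]
[cite: CheegerColding1997, (0.5) (p. 410)] -/
theorem indicator_jacobian_mul_sinh_pow_le [ConnectedSpace M] (hg : g.IsRiemannian)
    (hc : IsGeodesicallyComplete g.leviCivita)
    (hRic : ∀ (x : M) (w : TangentSpace 𝓘(ℝ, (EuclideanSpace ℝ (Fin d))) x),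
      -((d : ℝ) - 1) * g.val x w w ≤ g.leviCivita.ricci x w w)
    (p : M) (L : (EuclideanSpace ℝ (Fin d)) ≃L[ℝ] (EuclideanSpace ℝ (Fin d)))
    (hL : ∀ x y : (EuclideanSpace ℝ (Fin d)), g.val p (L x) (L y) = inner ℝ x y)
    (θ : (EuclideanSpace ℝ (Fin d))) (hθ : ‖θ‖ = 1) {u t : ℝ} (hu : 0 < u) (hut : u ≤ t) :
    {x : EuclideanSpace ℝ (Fin d) |
        (show TangentSpace 𝓘(ℝ, (EuclideanSpace ℝ (Fin d))) p from L x) ∈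
          injectivityDomain g hg p}.indicator
        (fun z ↦ ENNReal.ofReal (Real.sqrt (Matrix.of fun i j : Fin d ↦
          g.val (expMap g.leviCivita p (L z))
            (mfderiv 𝓘(ℝ, (EuclideanSpace ℝ (Fin d))) 𝓘(ℝ, (EuclideanSpace ℝ (Fin d)))
              (fun x : (EuclideanSpace ℝ (Fin d)) ↦ expMap g.leviCivita p (L x)) z
              (EuclideanSpace.single i 1))
            (mfderiv 𝓘(ℝ, (EuclideanSpace ℝ (Fin d))) 𝓘(ℝ, (EuclideanSpace ℝ (Fin d)))
              (fun x : (EuclideanSpace ℝ (Fin d)) ↦ expMap g.leviCivita p (L x)) z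
              (EuclideanSpace.single j 1))).det)) (t • θ) *
        ENNReal.ofReal (t ^ (d - 1)) * ENNReal.ofReal (Real.sinh u ^ (d - 1)) ≤
      {x : EuclideanSpace ℝ (Fin d) |
        (show TangentSpace 𝓘(ℝ, (EuclideanSpace ℝ (Fin d))) p from L x) ∈
          injectivityDomain g hg p}.indicator
        (fun z ↦ ENNReal.ofReal (Real.sqrt (Matrix.of fun i j : Fin d ↦
          g.val (expMap g.leviCivita p (L z))
            (mfderiv 𝓘(ℝ, (EuclideanSpace ℝ (Fin d))) 𝓘(ℝ, (EuclideanSpace ℝ (Fin d)))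
              (fun x : (EuclideanSpace ℝ (Fin d)) ↦ expMap g.leviCivita p (L x)) z
              (EuclideanSpace.single i 1))
            (mfderiv 𝓘(ℝ, (EuclideanSpace ℝ (Fin d))) 𝓘(ℝ, (EuclideanSpace ℝ (Fin d)))
              (fun x : (EuclideanSpace ℝ (Fin d)) ↦ expMap g.leviCivita p (L x)) z
              (EuclideanSpace.single j 1))).det)) (u • θ) *
        ENNReal.ofReal (u ^ (d - 1)) * ENNReal.ofReal (Real.sinh t ^ (d - 1)) := by
  classical
  haveI : Fact ((1 : ℕ∞ω) ≤ ((⊤ : ℕ∞) : ℕ∞ω)) := ⟨by exact_mod_cast le_top⟩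
  set W : Set (EuclideanSpace ℝ (Fin d)) := {x | (show TangentSpace 𝓘(ℝ, (EuclideanSpace ℝ (Fin d))) p
    from L x) ∈ injectivityDomain g hg p} with hW_def
  have hstar : ∀ x ∈ W, ∀ s : ℝ, 0 < s → s ≤ 1 → s • x ∈ W := by
    intro x hx s hs0 hs1
    show (show TangentSpace 𝓘(ℝ, (EuclideanSpace ℝ (Fin d))) p from L (s • x)) ∈
      injectivityDomain g hg p
    rw [map_smul]
    exact smul_mem_injectivityDomain hg hc hx hs0.le hs1
  have ht : 0 < t := hu.trans_le hut
  by_cases htW : t • θ ∈ W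
  · have huW : u • θ ∈ W := by
      have : u • θ = (u / t) • (t • θ) := by rw [smul_smul, div_mul_cancel₀ u ht.ne']
      rw [this]
      exact hstar _ htW _ (div_pos hu ht) ((div_le_one ht).2 hut)
    rw [indicator_of_mem htW, indicator_of_mem huW]
    obtain ⟨s', hs', hmin⟩ := htW
    have hmin' : IsMinimizingUpTo g hg p
        (show TangentSpace 𝓘(ℝ, (EuclideanSpace ℝ (Fin d))) p from
          (L θ : (EuclideanSpace ℝ (Fin d)))) (t * s') := by
      refine (isMinimizingUpTo_smul_iff hg hc p _ ht s').1 ?_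
      have key : ∀ w w' : (EuclideanSpace ℝ (Fin d)), w = w' →
          IsMinimizingUpTo g hg p (show TangentSpace 𝓘(ℝ, (EuclideanSpace ℝ (Fin d))) p from w) s' →
          IsMinimizingUpTo g hg p (show TangentSpace 𝓘(ℝ, (EuclideanSpace ℝ (Fin d))) p from w') s' := by
        rintro w w' rfl h'
        exact h'
      exact key _ _ (L.map_smul t θ) hmin
    have hinjt : ∀ τ ∈ Ioo 0 (t * s'), Injective (mfderiv 𝓘(ℝ, (EuclideanSpace ℝ (Fin d)))
        𝓘(ℝ, (EuclideanSpace ℝ (Fin d)))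
        (fun v : (EuclideanSpace ℝ (Fin d)) ↦ expMap g.leviCivita p
          (show TangentSpace 𝓘(ℝ, (EuclideanSpace ℝ (Fin d))) p from v))
        (τ • (L θ : (EuclideanSpace ℝ (Fin d))))) := by
      intro τ hτ
      have hmem : (show TangentSpace 𝓘(ℝ, (EuclideanSpace ℝ (Fin d))) p from
          τ • (L θ : (EuclideanSpace ℝ (Fin d)))) ∈ injectivityDomain g hg p := by
        refine ⟨t * s' / τ, by rw [lt_div_iff₀ hτ.1, one_mul]; exact hτ.2, ?_⟩
        exact (isMinimizingUpTo_smul_iff hg hc p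
          (show TangentSpace 𝓘(ℝ, (EuclideanSpace ℝ (Fin d))) p from
            (L θ : (EuclideanSpace ℝ (Fin d)))) hτ.1 (t * s' / τ)).2
          (by rw [mul_div_cancel₀ _ hτ.1.ne']; exact hmin')
      exact mfderiv_riemannianExpMap_injective_of_mem_injectivityDomain g le_rfl hg hc p hmem
    have hb : 0 < t * s' := mul_pos ht (zero_lt_one.trans hs')
    have htb : t < t * s' := lt_mul_of_one_lt_right ht hs'
    have key := sqrt_det_gram_expMap_ray_mul_sinh_pow_le g hg hc hRic p L hL θ hθ hb hinjt
      hu hut htb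
    rw [← ENNReal.ofReal_mul (Real.sqrt_nonneg _), ← ENNReal.ofReal_mul
      (mul_nonneg (Real.sqrt_nonneg _) (pow_nonneg ht.le _)), ← ENNReal.ofReal_mul (Real.sqrt_nonneg _),
      ← ENNReal.ofReal_mul (mul_nonneg (Real.sqrt_nonneg _) (pow_nonneg hu.le _))]
    exact ENNReal.ofReal_le_ofReal key
  · rw [indicator_of_notMem htW, zero_mul, zero_mul]
    exact zero_le

omit [ChartedSpace (EuclideanSpace ℝ (Fin d)) M] [IsManifold 𝓘(ℝ, EuclideanSpace ℝ (Fin d)) ∞ M]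
  [T2Space M] [g.HasLeviCivita] [CovariantDerivative.ContMDiffCovariantDerivative g.leviCivita 1]
  [CovariantDerivative.ContMDiffCovariantDerivative g.leviCivita ∞] in
/-- Radial sections of the indicator of the shell `{a ≤ |x| < b}` (`0 < a`): along the ray
`t ↦ tθ`, `|θ| = 1`, the integral over `(0, ∞)` of `(𝟙_{shell} Ψ)(tθ) t^k` is the integral of
`Ψ(tθ) t^k` over `[a, b)`. [folklore] -/
theorem lintegral_Ioi_indicator_shell_Ico {Ψ : (EuclideanSpace ℝ (Fin d)) → ℝ≥0∞} (k : ℕ)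
    {θ : (EuclideanSpace ℝ (Fin d))} (hθ : ‖θ‖ = 1) {a b : ℝ} (ha : 0 < a) :
    ∫⁻ t in Ioi (0 : ℝ), {x : (EuclideanSpace ℝ (Fin d)) | a ≤ ‖x‖ ∧ ‖x‖ < b}.indicator Ψ (t • θ) *
        ENNReal.ofReal (t ^ k) =
      ∫⁻ t in Ico a b, Ψ (t • θ) * ENNReal.ofReal (t ^ k) := by
  rw [setLIntegral_congr_fun measurableSet_Ioi (g := (Ico a b).indicator fun r ↦
    Ψ (r • θ) * ENNReal.ofReal (r ^ k)) ?_, lintegral_indicator measurableSet_Ico,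
    Measure.restrict_restrict measurableSet_Ico,
    inter_eq_left.2 (show Ico a b ⊆ Ioi (0 : ℝ) from fun r hr ↦ ha.trans_le hr.1)]
  intro r hr
  beta_reduce
  have hnr : ‖r • θ‖ = r := norm_smul_of_norm_eq_one hθ hr
  by_cases h : a ≤ r ∧ r < b
  · rw [indicator_of_mem (show r • θ ∈ {x : (EuclideanSpace ℝ (Fin d)) | a ≤ ‖x‖ ∧ ‖x‖ < b} by
      simpa [hnr] using h), indicator_of_mem (show r ∈ Ico a b from h)]
  · rw [indicator_of_notMem (show r • θ ∉ {x : (EuclideanSpace ℝ (Fin d)) | a ≤ ‖x‖ ∧ ‖x‖ < b} by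
      simpa [hnr] using h), indicator_of_notMem (show r ∉ Ico a b from h), zero_mul]

omit [ChartedSpace (EuclideanSpace ℝ (Fin d)) M] [IsManifold 𝓘(ℝ, EuclideanSpace ℝ (Fin d)) ∞ M]
  [T2Space M] [g.HasLeviCivita] [CovariantDerivative.ContMDiffCovariantDerivative g.leviCivita 1]
  [CovariantDerivative.ContMDiffCovariantDerivative g.leviCivita ∞] in
/-- Radial sections of the indicator of the shell `{a < |x| ≤ b}` (`0 ≤ a`): the integral over
`(0, ∞)` of `(𝟙_{shell} Ψ)(tθ) t^k` is the integral of `Ψ(tθ) t^k` over `(a, b]`. [folklore] -/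
theorem lintegral_Ioi_indicator_shell_Ioc {Ψ : (EuclideanSpace ℝ (Fin d)) → ℝ≥0∞} (k : ℕ)
    {θ : (EuclideanSpace ℝ (Fin d))} (hθ : ‖θ‖ = 1) {a b : ℝ} (ha : 0 ≤ a) :
    ∫⁻ t in Ioi (0 : ℝ), {x : (EuclideanSpace ℝ (Fin d)) | a < ‖x‖ ∧ ‖x‖ ≤ b}.indicator Ψ (t • θ) *
        ENNReal.ofReal (t ^ k) =
      ∫⁻ t in Ioc a b, Ψ (t • θ) * ENNReal.ofReal (t ^ k) := by
  rw [setLIntegral_congr_fun measurableSet_Ioi (g := (Ioc a b).indicator fun r ↦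
    Ψ (r • θ) * ENNReal.ofReal (r ^ k)) ?_, lintegral_indicator measurableSet_Ioc,
    Measure.restrict_restrict measurableSet_Ioc,
    inter_eq_left.2 (show Ioc a b ⊆ Ioi (0 : ℝ) from fun r hr ↦ ha.trans_lt hr.1)]
  intro r hr
  beta_reduce
  have hnr : ‖r • θ‖ = r := norm_smul_of_norm_eq_one hθ hr
  by_cases h : a < r ∧ r ≤ b
  · rw [indicator_of_mem (show r • θ ∈ {x : (EuclideanSpace ℝ (Fin d)) | a < ‖x‖ ∧ ‖x‖ ≤ b} by
      simpa [hnr] using h), indicator_of_mem (show r ∈ Ioc a b from h)]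
  · rw [indicator_of_notMem (show r • θ ∉ {x : (EuclideanSpace ℝ (Fin d)) | a < ‖x‖ ∧ ‖x‖ ≤ b} by
      simpa [hnr] using h), indicator_of_notMem (show r ∉ Ioc a b from h), zero_mul]

end Radial

/-! ### §4. Relative volume comparison for annuli -/

section Annuli

variable {d : ℕ} {M : Type*} [TopologicalSpace M] [ChartedSpace (EuclideanSpace ℝ (Fin d)) M]
  [IsManifold 𝓘(ℝ, EuclideanSpace ℝ (Fin d)) ∞ M] [T2Space M]
  (g : PseudoRiemannianMetric 𝓘(ℝ, EuclideanSpace ℝ (Fin d)) ∞ (EuclideanSpace ℝ (Fin d))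
    (TangentSpace 𝓘(ℝ, EuclideanSpace ℝ (Fin d)) : M → Type _)) [g.HasLeviCivita]
  [CovariantDerivative.ContMDiffCovariantDerivative g.leviCivita 1]
  [CovariantDerivative.ContMDiffCovariantDerivative g.leviCivita ∞]

/-- **Relative volume comparison for annuli, `Ric ≥ -(d-1)`** (Zhu 1997, Thm. 3.1: for
`0 ≤ s₁ ≤ s₂ ≤ r₁ ≤ r₂`, `Vol(A_{r₁,r₂}(p))/Vol(A_{s₁,s₂}(p)) ≤ (V(r₂) - V(r₁))/(V(s₂) - V(s₁))`;
(A.2.2) of Cheeger–Colding 1997 with `U` the whole annulus). On a connected Riemannian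
`d`-manifold (`d ≥ 1`) with geodesically complete Levi-Civita connection and `Ric ≥ -(d-1) g`,
for `p ∈ M` and `0 ≤ s₁ ≤ s₂ ≤ r₁ ≤ r₂`, with the annuli `A_{r₁,r₂}(p) = {r₁ ≤ d(p,·) < r₂}`,
`A_{s₁,s₂}(p) = {s₁ < d(p,·) ≤ s₂}` (boundary conventions chosen to cover the ball case `s₁ = 0`
and immaterial otherwise):
`Vol A_{r₁,r₂}(p) · ∫_{s₁}^{s₂} sinh^{d-1} ≤ Vol A_{s₁,s₂}(p) · ∫_{r₁}^{r₂} sinh^{d-1}`.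
Proof: exponential polar coordinates (`expPolar_data`: the outer annulus is covered by the image
of `W ∩ {r₁ ≤ |x| < r₂}` and a null set, the image of `W ∩ {s₁ < |x| ≤ s₂}` lies in the inner
annulus), the radial comparison `indicator_jacobian_mul_sinh_pow_le` and the two-interval Gromov
lemma `setLIntegral_Ico_mul_setLIntegral_Ioc_le` on each ray, integrated over the sphere of
directions. [cite: Zhu1997, Thm. 3.1 and Lemma 3.2 (p. 226)]
[cite: CheegerColding1997, (A.2.2) (p. 473)] [cite: Chavel2006, §III.4, Thm. III.4.5] -/
theorem riemannianMeasure_annulus_mul_le_of_ricci_ge_neg (hd : 0 < d) [ConnectedSpace M]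
    [T3Space M] [MeasurableSpace M] [BorelSpace M] (hg : g.IsRiemannian)
    (hc : IsGeodesicallyComplete g.leviCivita)
    (hRic : ∀ (x : M) (w : TangentSpace 𝓘(ℝ, (EuclideanSpace ℝ (Fin d))) x),
      -((d : ℝ) - 1) * g.val x w w ≤ g.leviCivita.ricci x w w)
    (p : M) {s₁ s₂ r₁ r₂ : ℝ} (hs₁ : 0 ≤ s₁) (hs₁₂ : s₁ ≤ s₂) (hsr : s₂ ≤ r₁) (hr₁₂ : r₁ ≤ r₂) :
    riemannianMeasure (I := 𝓘(ℝ, (EuclideanSpace ℝ (Fin d)))) (g.toContMDiffRiemannianMetric hg)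
        {y : M | ENNReal.ofReal r₁ ≤ g.edist hg p y ∧ g.edist hg p y < ENNReal.ofReal r₂} *
        ENNReal.ofReal (∫ t in s₁..s₂, Real.sinh t ^ (d - 1)) ≤
      riemannianMeasure (I := 𝓘(ℝ, (EuclideanSpace ℝ (Fin d)))) (g.toContMDiffRiemannianMetric hg)
        {y : M | ENNReal.ofReal s₁ < g.edist hg p y ∧ g.edist hg p y ≤ ENNReal.ofReal s₂} *
        ENNReal.ofReal (∫ t in r₁..r₂, Real.sinh t ^ (d - 1)) := by
  classical
  -- the degenerate case `s₁ = s₂`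
  rcases hs₁₂.eq_or_lt with heq | hs₁₂'
  · rw [heq, intervalIntegral.integral_same, ENNReal.ofReal_zero, mul_zero]
    exact zero_le
  have hs₂ : 0 < s₂ := hs₁.trans_lt hs₁₂'
  have hr₁ : 0 < r₁ := hs₂.trans_le hsr
  haveI : Fact ((1 : ℕ∞ω) ≤ ((⊤ : ℕ∞) : ℕ∞ω)) := ⟨by exact_mod_cast le_top⟩
  obtain ⟨L, hL⟩ := exists_linearIsometry_tangentSpace g hg p
  obtain ⟨hinj, harea, ⟨N, hNm, hN0, hΦN, hpolar⟩, hseg⟩ := expPolar_data g hd hg hc p L hL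
  set h := g.toContMDiffRiemannianMetric hg with hh_def
  set vol : Measure M := riemannianMeasure (I := 𝓘(ℝ, (EuclideanSpace ℝ (Fin d)))) h with hvol
  set Φ : (EuclideanSpace ℝ (Fin d)) → M := fun x ↦ expMap g.leviCivita p (L x) with hΦ_def
  have hΦs : ContMDiff 𝓘(ℝ, (EuclideanSpace ℝ (Fin d))) 𝓘(ℝ, (EuclideanSpace ℝ (Fin d))) 1 Φ :=
    ((contMDiff_expMap_infty hc p).of_le (by exact_mod_cast le_top)).comp
      L.toContinuousLinearMap.contDiff.contMDiff
  set Jac : (EuclideanSpace ℝ (Fin d)) → ℝ≥0∞ := fun z ↦ ENNReal.ofReal (Real.sqrt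
    (Matrix.of fun i j : Fin d ↦ g.val (Φ z)
      (mfderiv 𝓘(ℝ, (EuclideanSpace ℝ (Fin d))) 𝓘(ℝ, (EuclideanSpace ℝ (Fin d))) Φ z
        (EuclideanSpace.single i 1))
      (mfderiv 𝓘(ℝ, (EuclideanSpace ℝ (Fin d))) 𝓘(ℝ, (EuclideanSpace ℝ (Fin d))) Φ z
        (EuclideanSpace.single j 1))).det) with hJac_def
  have hJac_meas : Measurable Jac :=
    ENNReal.measurable_ofReal.comp (continuous_sqrt_det_inner_mfderiv h hΦs).measurable
  set W : Set (EuclideanSpace ℝ (Fin d)) := {x | (show TangentSpace 𝓘(ℝ, (EuclideanSpace ℝ (Fin d))) p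
    from L x) ∈ injectivityDomain g hg p} with hW_def
  have hWo : IsOpen W :=
    (isOpen_injectivityDomain_of_isGeodesicallyComplete g le_rfl hg hc p).preimage L.continuous
  have hWm : MeasurableSet W := hWo.measurableSet
  set Ψ : (EuclideanSpace ℝ (Fin d)) → ℝ≥0∞ := W.indicator Jac with hΨ_def
  have hΨm : Measurable Ψ := hJac_meas.indicator hWm
  -- the shells in `T_pM`
  set Er : Set (EuclideanSpace ℝ (Fin d)) := {x | r₁ ≤ ‖x‖ ∧ ‖x‖ < r₂} with hEr
  set Es : Set (EuclideanSpace ℝ (Fin d)) := {x | s₁ < ‖x‖ ∧ ‖x‖ ≤ s₂} with hEs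
  have hErm : MeasurableSet Er :=
    (measurableSet_le measurable_const measurable_norm).inter
      (measurableSet_lt measurable_norm measurable_const)
  have hEsm : MeasurableSet Es :=
    (measurableSet_lt measurable_const measurable_norm).inter
      (measurableSet_le measurable_norm measurable_const)
  -- `∫_E Ψ = ∫_{W ∩ E} Jac` and polar coordinates
  have hΨint : ∀ E : Set (EuclideanSpace ℝ (Fin d)), MeasurableSet E →
      ∫⁻ z in W ∩ E, Jac z = ∫⁻ z, E.indicator Ψ z := fun E hE ↦ by
    rw [lintegral_indicator hE, hΨ_def, lintegral_indicator hWm, Measure.restrict_restrict hWm]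
  have hpolarR : ∫⁻ z, Er.indicator Ψ z = ∫⁻ θ : Metric.sphere (0 : (EuclideanSpace ℝ (Fin d))) 1,
      ∫⁻ t in Ico r₁ r₂, Ψ (t • (θ : (EuclideanSpace ℝ (Fin d)))) * ENNReal.ofReal (t ^ (d - 1)) ∂volume
        ∂(volume : Measure (EuclideanSpace ℝ (Fin d))).toSphere := by
    rw [lintegral_eq_lintegral_sphere_Ioi hd _ (hΨm.indicator hErm)]
    refine lintegral_congr fun θ ↦ ?_
    exact lintegral_Ioi_indicator_shell_Ico (d - 1) (mem_sphere_zero_iff_norm.1 θ.2) hr₁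
  have hpolarS : ∫⁻ z, Es.indicator Ψ z = ∫⁻ θ : Metric.sphere (0 : (EuclideanSpace ℝ (Fin d))) 1,
      ∫⁻ t in Ioc s₁ s₂, Ψ (t • (θ : (EuclideanSpace ℝ (Fin d)))) * ENNReal.ofReal (t ^ (d - 1)) ∂volume
        ∂(volume : Measure (EuclideanSpace ℝ (Fin d))).toSphere := by
    rw [lintegral_eq_lintegral_sphere_Ioi hd _ (hΨm.indicator hEsm)]
    refine lintegral_congr fun θ ↦ ?_
    exact lintegral_Ioi_indicator_shell_Ioc (d - 1) (mem_sphere_zero_iff_norm.1 θ.2) hs₁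
  -- the outer annulus is covered by `Φ(W ∩ Er) ∪ Φ(N)`
  have hcover : {y : M | ENNReal.ofReal r₁ ≤ g.edist hg p y ∧ g.edist hg p y < ENNReal.ofReal r₂} ⊆
      Φ '' (W ∩ Er) ∪ Φ '' N := by
    intro y hy
    obtain ⟨x, hxy, hnx, -, hxWN⟩ := hpolar y
    have hy' : ENNReal.ofReal r₁ ≤ g.edist hg p y ∧ g.edist hg p y < ENNReal.ofReal r₂ := hy
    have hxE : x ∈ Er := by
      rw [← hnx] at hy'
      exact ⟨(ENNReal.ofReal_le_ofReal_iff (norm_nonneg _)).1 hy'.1,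
        (ENNReal.ofReal_lt_ofReal_iff_of_nonneg (norm_nonneg _)).1 hy'.2⟩
    rcases hxWN with hxW | hxN
    · exact Or.inl ⟨x, ⟨hxW, hxE⟩, hxy⟩
    · exact Or.inr ⟨x, hxN, hxy⟩
  -- the image of `W ∩ Es` lies in the inner annulus
  have hsub : Φ '' (W ∩ Es) ⊆
      {y : M | ENNReal.ofReal s₁ < g.edist hg p y ∧ g.edist hg p y ≤ ENNReal.ofReal s₂} := by
    rintro y ⟨x, ⟨hxW, hxE⟩, rfl⟩
    have hdist := (hseg x hxW).1
    refine ⟨?_, ?_⟩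
    · show ENNReal.ofReal s₁ < g.edist hg p (expMap g.leviCivita p (L x))
      rw [hdist]; exact (ENNReal.ofReal_lt_ofReal_iff_of_nonneg hs₁).2 hxE.1
    · show g.edist hg p (expMap g.leviCivita p (L x)) ≤ ENNReal.ofReal s₂
      rw [hdist]; exact ENNReal.ofReal_le_ofReal hxE.2
  -- the model integrals
  have hGs : ∫⁻ t in Ioc s₁ s₂, ENNReal.ofReal (Real.sinh t ^ (d - 1)) =
      ENNReal.ofReal (∫ t in s₁..s₂, Real.sinh t ^ (d - 1)) :=
    setLIntegral_Ioc_sinh_pow_eq_ofReal (d - 1) hs₁ hs₁₂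
  have hGr : ∫⁻ t in Ico r₁ r₂, ENNReal.ofReal (Real.sinh t ^ (d - 1)) =
      ENNReal.ofReal (∫ t in r₁..r₂, Real.sinh t ^ (d - 1)) :=
    setLIntegral_Ico_sinh_pow_eq_ofReal (d - 1) hr₁.le hr₁₂
  have hsinh_meas : Measurable fun t : ℝ ↦ ENNReal.ofReal (Real.sinh t ^ (d - 1)) :=
    ENNReal.measurable_ofReal.comp (Real.continuous_sinh.pow _).measurable
  -- the per-ray inequality
  have hray : ∀ θ : (EuclideanSpace ℝ (Fin d)), ‖θ‖ = 1 →
      (∫⁻ t in Ico r₁ r₂, Ψ (t • θ) * ENNReal.ofReal (t ^ (d - 1))) *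
          (∫⁻ t in Ioc s₁ s₂, ENNReal.ofReal (Real.sinh t ^ (d - 1))) ≤
        (∫⁻ t in Ioc s₁ s₂, Ψ (t • θ) * ENNReal.ofReal (t ^ (d - 1))) *
          (∫⁻ t in Ico r₁ r₂, ENNReal.ofReal (Real.sinh t ^ (d - 1))) := by
    intro θ hθ
    have hF : Measurable fun t : ℝ ↦ Ψ (t • θ) * ENNReal.ofReal (t ^ (d - 1)) :=
      (hΨm.comp (continuous_id.smul continuous_const).measurable).mul
        (ENNReal.measurable_ofReal.comp (continuous_id.pow _).measurable)
    exact setLIntegral_Ico_mul_setLIntegral_Ioc_le hF hsinh_meas hs₁ hsr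
      (fun u t hu hut _ ↦ indicator_jacobian_mul_sinh_pow_le g hg hc hRic p L hL θ hθ hu hut)
  -- assembly
  rw [← hGs, ← hGr]
  have hGs_fin : ∫⁻ t in Ioc s₁ s₂, ENNReal.ofReal (Real.sinh t ^ (d - 1)) ≠ ⊤ := by
    rw [hGs]; exact ENNReal.ofReal_ne_top
  have hGr_fin : ∫⁻ t in Ico r₁ r₂, ENNReal.ofReal (Real.sinh t ^ (d - 1)) ≠ ⊤ := by
    rw [hGr]; exact ENNReal.ofReal_ne_top
  calc vol {y : M | ENNReal.ofReal r₁ ≤ g.edist hg p y ∧ g.edist hg p y < ENNReal.ofReal r₂} *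
        (∫⁻ t in Ioc s₁ s₂, ENNReal.ofReal (Real.sinh t ^ (d - 1)))
      ≤ (vol (Φ '' (W ∩ Er)) + vol (Φ '' N)) *
          (∫⁻ t in Ioc s₁ s₂, ENNReal.ofReal (Real.sinh t ^ (d - 1))) :=
        mul_le_mul' ((measure_mono hcover).trans (measure_union_le _ _)) le_rfl
    _ = (∫⁻ θ : Metric.sphere (0 : (EuclideanSpace ℝ (Fin d))) 1,
          ∫⁻ t in Ico r₁ r₂, Ψ (t • (θ : (EuclideanSpace ℝ (Fin d)))) * ENNReal.ofReal (t ^ (d - 1))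
            ∂volume ∂(volume : Measure (EuclideanSpace ℝ (Fin d))).toSphere) *
          (∫⁻ t in Ioc s₁ s₂, ENNReal.ofReal (Real.sinh t ^ (d - 1))) := by
        rw [hΦN, add_zero, harea _ (hWm.inter hErm) inter_subset_left, hΨint Er hErm, hpolarR]
    _ = ∫⁻ θ : Metric.sphere (0 : (EuclideanSpace ℝ (Fin d))) 1,
          (∫⁻ t in Ico r₁ r₂, Ψ (t • (θ : (EuclideanSpace ℝ (Fin d)))) * ENNReal.ofReal (t ^ (d - 1))
            ∂volume) *
            (∫⁻ t in Ioc s₁ s₂, ENNReal.ofReal (Real.sinh t ^ (d - 1)))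
          ∂(volume : Measure (EuclideanSpace ℝ (Fin d))).toSphere := by
        rw [lintegral_mul_const' _ _ hGs_fin]
    _ ≤ ∫⁻ θ : Metric.sphere (0 : (EuclideanSpace ℝ (Fin d))) 1,
          (∫⁻ t in Ioc s₁ s₂, Ψ (t • (θ : (EuclideanSpace ℝ (Fin d)))) * ENNReal.ofReal (t ^ (d - 1))
            ∂volume) *
            (∫⁻ t in Ico r₁ r₂, ENNReal.ofReal (Real.sinh t ^ (d - 1)))
          ∂(volume : Measure (EuclideanSpace ℝ (Fin d))).toSphere :=
        lintegral_mono fun θ ↦ hray θ (mem_sphere_zero_iff_norm.1 θ.2)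
    _ = (∫⁻ θ : Metric.sphere (0 : (EuclideanSpace ℝ (Fin d))) 1,
          ∫⁻ t in Ioc s₁ s₂, Ψ (t • (θ : (EuclideanSpace ℝ (Fin d)))) * ENNReal.ofReal (t ^ (d - 1))
            ∂volume ∂(volume : Measure (EuclideanSpace ℝ (Fin d))).toSphere) *
          (∫⁻ t in Ico r₁ r₂, ENNReal.ofReal (Real.sinh t ^ (d - 1))) := by
        rw [lintegral_mul_const' _ _ hGr_fin]
    _ = vol (Φ '' (W ∩ Es)) * (∫⁻ t in Ico r₁ r₂, ENNReal.ofReal (Real.sinh t ^ (d - 1))) := by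
        rw [← hpolarS, ← hΨint Es hEsm, harea _ (hWm.inter hEsm) inter_subset_left]
    _ ≤ vol {y : M | ENNReal.ofReal s₁ < g.edist hg p y ∧ g.edist hg p y ≤ ENNReal.ofReal s₂} *
          (∫⁻ t in Ico r₁ r₂, ENNReal.ofReal (Real.sinh t ^ (d - 1))) :=
        mul_le_mul' (measure_mono hsub) le_rfl

end Annuli

/-! ### §5. Directionally restricted relative volume comparison: (A.2.2) -/

section Sector

variable {d : ℕ} {M : Type*} [TopologicalSpace M] [ChartedSpace (EuclideanSpace ℝ (Fin d)) M]
  [IsManifold 𝓘(ℝ, EuclideanSpace ℝ (Fin d)) ∞ M] [T2Space M]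
  (g : PseudoRiemannianMetric 𝓘(ℝ, EuclideanSpace ℝ (Fin d)) ∞ (EuclideanSpace ℝ (Fin d))
    (TangentSpace 𝓘(ℝ, EuclideanSpace ℝ (Fin d)) : M → Type _)) [g.HasLeviCivita]
  [CovariantDerivative.ContMDiffCovariantDerivative g.leviCivita 1]
  [CovariantDerivative.ContMDiffCovariantDerivative g.leviCivita ∞]

/-- **Directionally restricted relative volume comparison — (A.2.2) of Cheeger–Colding 1997 for
smooth manifolds with `Ric ≥ -(n-1)`** ("a generalized version of mean curvature comparison",
p. 473: for `p ∈ X`, `0 < s₁ < s₂ < r₁ < r₂` and an open `U ⊆ A_{r₁,r₂}(p)`,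
`(V(s₂) - V(s₁))/ν(S_{s₁,s₂}(p, U)) ≤ (V(r₂) - V(r₁))/ν(U)`, where (A.2.1)
`S_{s₁,s₂}(p, U) = {x ∈ A_{s₁,s₂}(p) | d(p,x) + d(x,z) = d(p,z) for some z ∈ U}` is "the
intersection with `A_{s₁,s₂}(p)` of the angular sector consisting of minimal geodesics emanating
from `p` the ends of which lie in `U`"). On a connected Riemannian `d`-manifold (`d ≥ 1`) with
geodesically complete Levi-Civita connection and `Ric ≥ -(d-1) g`, for `p`, an open set `U`,
`0 ≤ s₁ ≤ s₂ ≤ r₁ ≤ r₂`, with `A_{r₁,r₂}(p) = {r₁ ≤ d(p,·) < r₂}`, `A_{s₁,s₂}(p) = {s₁ < d(p,·) ≤ s₂}`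
and `V` the hyperbolic model (`V(b) - V(a) = ∫ₐᵇ sinh^{d-1}` up to the constant `|S^{d-1}|`):
`Vol(U ∩ A_{r₁,r₂}(p)) · (V(s₂) - V(s₁)) ≤ Vol(S_{s₁,s₂}(p, U)) · (V(r₂) - V(r₁))`.
Proof: in exponential polar coordinates at `p` (`expPolar_data`), a direction `θ` whose ray meets
`W ∩ {r₁ ≤ |x| < r₂} ∩ F⁻¹U` in a set of positive length meets it at some radius `t₀ > r₁`, and
then the whole segment `{tθ : s₁ < t ≤ s₂}` consists of points of `W` mapped into
`S_{s₁,s₂}(p, U)` (sub-segments of the minimal segment to `F(t₀θ) ∈ U`,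
`edist_expMap_smul_of_isMinimizingUpTo`); on each such ray the two-interval Gromov lemma and
Bishop's monotonicity (`indicator_jacobian_mul_sinh_pow_le`) give the inequality of the radial
integrals, which is integrated over the sphere of directions (area formula on `W`, null cut set).
[cite: CheegerColding1997, Appendix 2, (A.2.1)–(A.2.2) (p. 473)]
[cite: Zhu1997, Thm. 3.1 and Lemma 3.2 (p. 226)] -/
theorem riemannianMeasure_inter_annulus_mul_le_sector_of_ricci_ge_neg (hd : 0 < d) [ConnectedSpace M]
    [T3Space M] [MeasurableSpace M] [BorelSpace M] (hg : g.IsRiemannian)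
    (hc : IsGeodesicallyComplete g.leviCivita)
    (hRic : ∀ (x : M) (w : TangentSpace 𝓘(ℝ, (EuclideanSpace ℝ (Fin d))) x),
      -((d : ℝ) - 1) * g.val x w w ≤ g.leviCivita.ricci x w w)
    (p : M) {U : Set M} (hU : IsOpen U) {s₁ s₂ r₁ r₂ : ℝ} (hs₁ : 0 ≤ s₁) (hs₁₂ : s₁ ≤ s₂)
    (hsr : s₂ ≤ r₁) (hr₁₂ : r₁ ≤ r₂) :
    riemannianMeasure (I := 𝓘(ℝ, (EuclideanSpace ℝ (Fin d)))) (g.toContMDiffRiemannianMetric hg)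
        (U ∩ {y : M | ENNReal.ofReal r₁ ≤ g.edist hg p y ∧ g.edist hg p y < ENNReal.ofReal r₂}) *
        ENNReal.ofReal (∫ t in s₁..s₂, Real.sinh t ^ (d - 1)) ≤
      riemannianMeasure (I := 𝓘(ℝ, (EuclideanSpace ℝ (Fin d)))) (g.toContMDiffRiemannianMetric hg)
        {x : M | ENNReal.ofReal s₁ < g.edist hg p x ∧ g.edist hg p x ≤ ENNReal.ofReal s₂ ∧
          ∃ z ∈ U, g.edist hg p x + g.edist hg x z = g.edist hg p z} *
        ENNReal.ofReal (∫ t in r₁..r₂, Real.sinh t ^ (d - 1)) := by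
  classical
  -- the degenerate case `s₁ = s₂`
  rcases hs₁₂.eq_or_lt with heq | hs₁₂'
  · rw [heq, intervalIntegral.integral_same, ENNReal.ofReal_zero, mul_zero]
    exact zero_le
  have hs₂ : 0 < s₂ := hs₁.trans_lt hs₁₂'
  have hr₁ : 0 < r₁ := hs₂.trans_le hsr
  haveI : Fact ((1 : ℕ∞ω) ≤ ((⊤ : ℕ∞) : ℕ∞ω)) := ⟨by exact_mod_cast le_top⟩
  obtain ⟨L, hL⟩ := exists_linearIsometry_tangentSpace g hg p
  obtain ⟨hinj, harea, ⟨N, hNm, hN0, hΦN, hpolar⟩, hseg⟩ := expPolar_data g hd hg hc p L hL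
  set h := g.toContMDiffRiemannianMetric hg with hh_def
  set vol : Measure M := riemannianMeasure (I := 𝓘(ℝ, (EuclideanSpace ℝ (Fin d)))) h with hvol
  set Φ : (EuclideanSpace ℝ (Fin d)) → M := fun x ↦ expMap g.leviCivita p (L x) with hΦ_def
  have hΦs : ContMDiff 𝓘(ℝ, (EuclideanSpace ℝ (Fin d))) 𝓘(ℝ, (EuclideanSpace ℝ (Fin d))) 1 Φ :=
    ((contMDiff_expMap_infty hc p).of_le (by exact_mod_cast le_top)).comp
      L.toContinuousLinearMap.contDiff.contMDiff
  set Jac : (EuclideanSpace ℝ (Fin d)) → ℝ≥0∞ := fun z ↦ ENNReal.ofReal (Real.sqrt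
    (Matrix.of fun i j : Fin d ↦ g.val (Φ z)
      (mfderiv 𝓘(ℝ, (EuclideanSpace ℝ (Fin d))) 𝓘(ℝ, (EuclideanSpace ℝ (Fin d))) Φ z
        (EuclideanSpace.single i 1))
      (mfderiv 𝓘(ℝ, (EuclideanSpace ℝ (Fin d))) 𝓘(ℝ, (EuclideanSpace ℝ (Fin d))) Φ z
        (EuclideanSpace.single j 1))).det) with hJac_def
  have hJac_meas : Measurable Jac :=
    ENNReal.measurable_ofReal.comp (continuous_sqrt_det_inner_mfderiv h hΦs).measurable
  set W : Set (EuclideanSpace ℝ (Fin d)) := {x | (show TangentSpace 𝓘(ℝ, (EuclideanSpace ℝ (Fin d))) p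
    from L x) ∈ injectivityDomain g hg p} with hW_def
  have hWo : IsOpen W :=
    (isOpen_injectivityDomain_of_isGeodesicallyComplete g le_rfl hg hc p).preimage L.continuous
  have hWm : MeasurableSet W := hWo.measurableSet
  have hstar : ∀ x ∈ W, ∀ s : ℝ, 0 < s → s ≤ 1 → s • x ∈ W := by
    intro x hx s hs0 hs1
    show (show TangentSpace 𝓘(ℝ, (EuclideanSpace ℝ (Fin d))) p from L (s • x)) ∈
      injectivityDomain g hg p
    rw [map_smul]
    exact smul_mem_injectivityDomain hg hc hx hs0.le hs1
  set Ψ : (EuclideanSpace ℝ (Fin d)) → ℝ≥0∞ := W.indicator Jac with hΨ_def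
  have hΨm : Measurable Ψ := hJac_meas.indicator hWm
  -- the sets in `T_pM`: the part of the outer shell mapped into `U`, and the cone `C` over it
  set Er : Set (EuclideanSpace ℝ (Fin d)) := {x | r₁ ≤ ‖x‖ ∧ ‖x‖ < r₂} with hEr
  set Es : Set (EuclideanSpace ℝ (Fin d)) := {x | s₁ < ‖x‖ ∧ ‖x‖ ≤ s₂} with hEs
  have hErm : MeasurableSet Er :=
    (measurableSet_le measurable_const measurable_norm).inter
      (measurableSet_lt measurable_norm measurable_const)
  have hEsm : MeasurableSet Es :=
    (measurableSet_lt measurable_const measurable_norm).inter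
      (measurableSet_le measurable_norm measurable_const)
  have hUo : IsOpen (Φ ⁻¹' U) := hU.preimage hΦs.continuous
  set EU : Set (EuclideanSpace ℝ (Fin d)) := Er ∩ Φ ⁻¹' U with hEU
  have hEUm : MeasurableSet EU := hErm.inter hUo.measurableSet
  set G : Set (EuclideanSpace ℝ (Fin d)) := W ∩ Φ ⁻¹' U ∩ {x | r₁ < ‖x‖ ∧ ‖x‖ < r₂} with hG
  have hGo : IsOpen G :=
    (hWo.inter hUo).inter ((isOpen_lt continuous_const continuous_norm).inter
      (isOpen_lt continuous_norm continuous_const))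
  set H : Set (EuclideanSpace ℝ (Fin d)) := ⋃ τ ∈ Ioi (1 : ℝ),
    (fun x : (EuclideanSpace ℝ (Fin d)) ↦ τ • x) ⁻¹' G with hH
  have hHo : IsOpen H := isOpen_biUnion fun τ _ ↦ hGo.preimage (continuous_const_smul τ)
  have hmemH : ∀ {x : (EuclideanSpace ℝ (Fin d))} {τ : ℝ}, 1 < τ → τ • x ∈ G → x ∈ H :=
    fun {x} {τ} hτ hx ↦ mem_iUnion₂.2 ⟨τ, hτ, hx⟩
  set C : Set (EuclideanSpace ℝ (Fin d)) := Es ∩ H with hC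
  have hCm : MeasurableSet C := hEsm.inter hHo.measurableSet
  -- `U ∩ A_{r₁,r₂}` is covered by `Φ(W ∩ EU) ∪ Φ(N)`
  have hcover : U ∩ {y : M | ENNReal.ofReal r₁ ≤ g.edist hg p y ∧ g.edist hg p y < ENNReal.ofReal r₂} ⊆
      Φ '' (W ∩ EU) ∪ Φ '' N := by
    rintro y ⟨hyU, hy⟩
    obtain ⟨x, hxy, hnx, -, hxWN⟩ := hpolar y
    have hy' : ENNReal.ofReal r₁ ≤ g.edist hg p y ∧ g.edist hg p y < ENNReal.ofReal r₂ := hy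
    have hxE : x ∈ EU := by
      rw [← hnx] at hy'
      refine ⟨⟨(ENNReal.ofReal_le_ofReal_iff (norm_nonneg _)).1 hy'.1,
        (ENNReal.ofReal_lt_ofReal_iff_of_nonneg (norm_nonneg _)).1 hy'.2⟩, ?_⟩
      show Φ x ∈ U
      rw [show Φ x = y from hxy]; exact hyU
    rcases hxWN with hxW | hxN
    · exact Or.inl ⟨x, ⟨hxW, hxE⟩, hxy⟩
    · exact Or.inr ⟨x, hxN, hxy⟩
  -- `Φ(W ∩ C)` lies in the sector `S_{s₁,s₂}(p, U)`
  have hsub : Φ '' (W ∩ C) ⊆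
      {x : M | ENNReal.ofReal s₁ < g.edist hg p x ∧ g.edist hg p x ≤ ENNReal.ofReal s₂ ∧
        ∃ z ∈ U, g.edist hg p x + g.edist hg x z = g.edist hg p z} := by
    rintro y ⟨v, ⟨hvW, hvE, hvH⟩, rfl⟩
    obtain ⟨τ, hτ, hτv⟩ := mem_iUnion₂.1 hvH
    have hτ1 : (1 : ℝ) < τ := hτ
    have hτ0 : 0 < τ := zero_lt_one.trans hτ1
    obtain ⟨⟨hτW, hτU⟩, -⟩ := hτv
    have hdv := (hseg v hvW).1
    have hdτ := (hseg (τ • v) hτW).1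
    have hseg' := (hseg (τ • v) hτW).2 (1 / τ) ⟨by positivity, (div_le_one hτ0).2 hτ1.le⟩ 1
      ⟨zero_le_one, le_rfl⟩
    rw [one_smul, smul_smul, one_div_mul_cancel hτ0.ne', one_smul] at hseg'
    refine ⟨?_, ?_, Φ (τ • v), hτU, ?_⟩
    · show ENNReal.ofReal s₁ < g.edist hg p (expMap g.leviCivita p (L v))
      rw [hdv]; exact (ENNReal.ofReal_lt_ofReal_iff_of_nonneg hs₁).2 hvE.1
    · show g.edist hg p (expMap g.leviCivita p (L v)) ≤ ENNReal.ofReal s₂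
      rw [hdv]; exact ENNReal.ofReal_le_ofReal hvE.2
    · show g.edist hg p (expMap g.leviCivita p (L v)) +
          g.edist hg (expMap g.leviCivita p (L v)) (expMap g.leviCivita p (L (τ • v))) =
        g.edist hg p (expMap g.leviCivita p (L (τ • v)))
      rw [hdv, hseg', hdτ, norm_smul, Real.norm_eq_abs, abs_of_pos hτ0,
        ← ENNReal.ofReal_add (norm_nonneg _) (mul_nonneg (abs_nonneg _)
          (mul_nonneg hτ0.le (norm_nonneg _)))]
      congr 1
      rw [abs_of_nonpos (by rw [sub_nonpos, div_le_one hτ0]; exact hτ1.le)]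
      field_simp
      ring
  -- `∫_{W ∩ E} Jac` in polar coordinates
  have hpolar_int : ∀ E : Set (EuclideanSpace ℝ (Fin d)), MeasurableSet E →
      ∫⁻ z in W ∩ E, Jac z = ∫⁻ θ : Metric.sphere (0 : (EuclideanSpace ℝ (Fin d))) 1,
        ∫⁻ t in Ioi (0 : ℝ), (W ∩ E).indicator Jac (t • (θ : (EuclideanSpace ℝ (Fin d)))) *
          ENNReal.ofReal (t ^ (d - 1)) ∂volume
        ∂(volume : Measure (EuclideanSpace ℝ (Fin d))).toSphere := fun E hE ↦ by
    rw [← lintegral_indicator (hWm.inter hE),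
      lintegral_eq_lintegral_sphere_Ioi hd _ (hJac_meas.indicator (hWm.inter hE))]
  -- the model integrals
  have hGs : ∫⁻ t in Ioc s₁ s₂, ENNReal.ofReal (Real.sinh t ^ (d - 1)) =
      ENNReal.ofReal (∫ t in s₁..s₂, Real.sinh t ^ (d - 1)) :=
    setLIntegral_Ioc_sinh_pow_eq_ofReal (d - 1) hs₁ hs₁₂
  have hGr : ∫⁻ t in Ico r₁ r₂, ENNReal.ofReal (Real.sinh t ^ (d - 1)) =
      ENNReal.ofReal (∫ t in r₁..r₂, Real.sinh t ^ (d - 1)) :=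
    setLIntegral_Ico_sinh_pow_eq_ofReal (d - 1) hr₁.le hr₁₂
  have hGs_fin : ∫⁻ t in Ioc s₁ s₂, ENNReal.ofReal (Real.sinh t ^ (d - 1)) ≠ ⊤ := by
    rw [hGs]; exact ENNReal.ofReal_ne_top
  have hGr_fin : ∫⁻ t in Ico r₁ r₂, ENNReal.ofReal (Real.sinh t ^ (d - 1)) ≠ ⊤ := by
    rw [hGr]; exact ENNReal.ofReal_ne_top
  have hsinh_meas : Measurable fun t : ℝ ↦ ENNReal.ofReal (Real.sinh t ^ (d - 1)) :=
    ENNReal.measurable_ofReal.comp (Real.continuous_sinh.pow _).measurable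
  -- THE PER-RAY INEQUALITY
  have hray : ∀ θ : (EuclideanSpace ℝ (Fin d)), ‖θ‖ = 1 →
      (∫⁻ t in Ioi (0 : ℝ), (W ∩ EU).indicator Jac (t • θ) * ENNReal.ofReal (t ^ (d - 1))) *
          (∫⁻ t in Ioc s₁ s₂, ENNReal.ofReal (Real.sinh t ^ (d - 1))) ≤
        (∫⁻ t in Ioi (0 : ℝ), (W ∩ C).indicator Jac (t • θ) * ENNReal.ofReal (t ^ (d - 1))) *
          (∫⁻ t in Ico r₁ r₂, ENNReal.ofReal (Real.sinh t ^ (d - 1))) := by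
    intro θ hθ
    set FU : ℝ → ℝ≥0∞ := fun t ↦ (W ∩ EU).indicator Jac (t • θ) * ENNReal.ofReal (t ^ (d - 1))
      with hFU
    set FC : ℝ → ℝ≥0∞ := fun t ↦ (W ∩ C).indicator Jac (t • θ) * ENNReal.ofReal (t ^ (d - 1))
      with hFC
    set F : ℝ → ℝ≥0∞ := fun t ↦ Ψ (t • θ) * ENNReal.ofReal (t ^ (d - 1)) with hF
    have hsm : Measurable fun t : ℝ ↦ t • θ := (continuous_id.smul continuous_const).measurable
    have hpm : Measurable fun t : ℝ ↦ ENNReal.ofReal (t ^ (d - 1)) :=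
      ENNReal.measurable_ofReal.comp (continuous_id.pow _).measurable
    have hFUm : Measurable FU := ((hJac_meas.indicator (hWm.inter hEUm)).comp hsm).mul hpm
    have hFm : Measurable F := (hΨm.comp hsm).mul hpm
    have hnorm : ∀ {t : ℝ}, 0 < t → ‖t • θ‖ = t := fun ht ↦ norm_smul_of_norm_eq_one hθ ht
    show (∫⁻ t in Ioi (0 : ℝ), FU t) * _ ≤ (∫⁻ t in Ioi (0 : ℝ), FC t) * _
    by_cases hzero : ∫⁻ t in Ioi (0 : ℝ), FU t = 0
    · rw [hzero, zero_mul]; exact zero_le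
    -- a radius `t₀ ∈ (r₁, r₂)` on the ray with `t₀ θ ∈ W`, `Φ(t₀ θ) ∈ U`
    obtain ⟨t₀, ht₀W, ht₀U, hrt₀, ht₀r⟩ : ∃ t₀ : ℝ, t₀ • θ ∈ W ∧ Φ (t₀ • θ) ∈ U ∧ r₁ < t₀ ∧ t₀ < r₂ := by
      set μ₀ : Measure ℝ := volume.restrict (Ioi (0 : ℝ)) with hμ₀
      have hsupp : μ₀ {t | FU t ≠ 0} ≠ 0 := by
        intro h0
        apply hzero
        refine (lintegral_eq_zero_iff' hFUm.aemeasurable).2 ?_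
        filter_upwards [measure_eq_zero_iff_ae_notMem.1 h0] with t ht
        simp only [not_not] at ht
        exact ht
      have hμr : μ₀ {r₁} = 0 := by
        rw [hμ₀, Measure.restrict_apply (measurableSet_singleton r₁)]
        exact measure_mono_null inter_subset_left (measure_singleton r₁)
      have hdiff : μ₀ ({t | FU t ≠ 0} \ {r₁}) ≠ 0 := by rwa [measure_sdiff_null hμr]
      rw [hμ₀, Measure.restrict_apply' measurableSet_Ioi] at hdiff
      obtain ⟨t₀, ⟨ht₀, ht₀r₁⟩, ht₀0⟩ := nonempty_of_measure_ne_zero hdiff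
      have ht₀0 : 0 < t₀ := ht₀0
      have hne : (W ∩ EU).indicator Jac (t₀ • θ) ≠ 0 := fun h0 ↦ ht₀ (by
        show FU t₀ = 0
        rw [hFU]; simp only [h0, zero_mul])
      obtain ⟨hW', ⟨hE1, hE2⟩, hU'⟩ := mem_of_indicator_ne_zero hne
      rw [hnorm ht₀0] at hE1 hE2
      exact ⟨t₀, hW', hU', lt_of_le_of_ne hE1 (fun h ↦ ht₀r₁ h.symm), hE2⟩
    have ht₀ : 0 < t₀ := hr₁.trans hrt₀
    -- on `(s₁, s₂]` the ray lies in `W ∩ C`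
    have hmemC : ∀ t ∈ Ioc s₁ s₂, t • θ ∈ W ∩ C := by
      intro t ht
      have ht0 : 0 < t := hs₁.trans_lt ht.1
      have htt₀ : t < t₀ := (ht.2.trans hsr).trans_lt hrt₀
      have hτ : 1 < t₀ / t := (one_lt_div ht0).2 htt₀
      have hsmul : (t₀ / t) • (t • θ) = t₀ • θ := by rw [smul_smul, div_mul_cancel₀ t₀ ht0.ne']
      refine ⟨?_, ⟨by rw [hnorm ht0]; exact ht.1, by rw [hnorm ht0]; exact ht.2⟩, hmemH hτ ?_⟩
      · have : t • θ = (t / t₀) • (t₀ • θ) := by rw [smul_smul, div_mul_cancel₀ t ht₀.ne']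
        rw [this]
        exact hstar _ ht₀W _ (div_pos ht0 ht₀) ((div_le_one ht₀).2 htt₀.le)
      · rw [hsmul]
        exact ⟨⟨ht₀W, ht₀U⟩, by rw [hnorm ht₀]; exact hrt₀, by rw [hnorm ht₀]; exact ht₀r⟩
    -- `∫ FU ≤ ∫_{[r₁,r₂)} F` and `∫_{(s₁,s₂]} F ≤ ∫ FC`
    have hFU_le : ∫⁻ t in Ioi (0 : ℝ), FU t ≤ ∫⁻ t in Ico r₁ r₂, F t := by
      have hpt : ∀ t ∈ Ioi (0 : ℝ), FU t ≤ (Ico r₁ r₂).indicator F t := by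
        intro t ht
        by_cases hmem : t • θ ∈ W ∩ EU
        · have htI : t ∈ Ico r₁ r₂ := by
            obtain ⟨-, ⟨h1, h2⟩, -⟩ := hmem
            rw [hnorm ht] at h1 h2
            exact ⟨h1, h2⟩
          rw [indicator_of_mem htI, hFU, hF]
          simp only []
          rw [indicator_of_mem hmem, hΨ_def, indicator_of_mem hmem.1]
        · rw [hFU]
          simp only []
          rw [indicator_of_notMem hmem, zero_mul]
          exact zero_le
      calc ∫⁻ t in Ioi (0 : ℝ), FU t ≤ ∫⁻ t in Ioi (0 : ℝ), (Ico r₁ r₂).indicator F t :=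
            lintegral_mono_ae (ae_restrict_of_forall_mem measurableSet_Ioi hpt)
        _ = ∫⁻ t in Ico r₁ r₂, F t := by
            rw [lintegral_indicator measurableSet_Ico, Measure.restrict_restrict measurableSet_Ico,
              inter_eq_left.2 (show Ico r₁ r₂ ⊆ Ioi (0 : ℝ) from fun r hr ↦ hr₁.trans_le hr.1)]
    have hFC_ge : ∫⁻ t in Ioc s₁ s₂, F t ≤ ∫⁻ t in Ioi (0 : ℝ), FC t := by
      calc ∫⁻ t in Ioc s₁ s₂, F t = ∫⁻ t in Ioc s₁ s₂, FC t := by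
            refine setLIntegral_congr_fun measurableSet_Ioc fun t ht ↦ ?_
            rw [hF, hFC]
            simp only []
            rw [indicator_of_mem (hmemC t ht), hΨ_def, indicator_of_mem (hmemC t ht).1]
        _ ≤ ∫⁻ t in Ioi (0 : ℝ), FC t :=
            lintegral_mono_set (show Ioc s₁ s₂ ⊆ Ioi (0 : ℝ) from fun r hr ↦ hs₁.trans_lt hr.1)
    have hGromov := setLIntegral_Ico_mul_setLIntegral_Ioc_le hFm hsinh_meas hs₁ hsr (r₂ := r₂)
      (fun u t hu hut _ ↦ indicator_jacobian_mul_sinh_pow_le g hg hc hRic p L hL θ hθ hu hut)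
    calc (∫⁻ t in Ioi (0 : ℝ), FU t) * (∫⁻ t in Ioc s₁ s₂, ENNReal.ofReal (Real.sinh t ^ (d - 1)))
        ≤ (∫⁻ t in Ico r₁ r₂, F t) * (∫⁻ t in Ioc s₁ s₂, ENNReal.ofReal (Real.sinh t ^ (d - 1))) :=
          mul_le_mul' hFU_le le_rfl
      _ ≤ (∫⁻ t in Ioc s₁ s₂, F t) * (∫⁻ t in Ico r₁ r₂, ENNReal.ofReal (Real.sinh t ^ (d - 1))) :=
          hGromov
      _ ≤ (∫⁻ t in Ioi (0 : ℝ), FC t) * (∫⁻ t in Ico r₁ r₂, ENNReal.ofReal (Real.sinh t ^ (d - 1))) :=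
          mul_le_mul' hFC_ge le_rfl
  -- assembly
  rw [← hGs, ← hGr]
  calc vol (U ∩ {y : M | ENNReal.ofReal r₁ ≤ g.edist hg p y ∧ g.edist hg p y < ENNReal.ofReal r₂}) *
        (∫⁻ t in Ioc s₁ s₂, ENNReal.ofReal (Real.sinh t ^ (d - 1)))
      ≤ (vol (Φ '' (W ∩ EU)) + vol (Φ '' N)) *
          (∫⁻ t in Ioc s₁ s₂, ENNReal.ofReal (Real.sinh t ^ (d - 1))) :=
        mul_le_mul' ((measure_mono hcover).trans (measure_union_le _ _)) le_rfl
    _ = (∫⁻ θ : Metric.sphere (0 : (EuclideanSpace ℝ (Fin d))) 1,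
          ∫⁻ t in Ioi (0 : ℝ), (W ∩ EU).indicator Jac (t • (θ : (EuclideanSpace ℝ (Fin d)))) *
            ENNReal.ofReal (t ^ (d - 1)) ∂volume
            ∂(volume : Measure (EuclideanSpace ℝ (Fin d))).toSphere) *
          (∫⁻ t in Ioc s₁ s₂, ENNReal.ofReal (Real.sinh t ^ (d - 1))) := by
        rw [hΦN, add_zero, harea _ (hWm.inter hEUm) inter_subset_left, hpolar_int EU hEUm]
    _ = ∫⁻ θ : Metric.sphere (0 : (EuclideanSpace ℝ (Fin d))) 1,
          (∫⁻ t in Ioi (0 : ℝ), (W ∩ EU).indicator Jac (t • (θ : (EuclideanSpace ℝ (Fin d)))) *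
            ENNReal.ofReal (t ^ (d - 1)) ∂volume) *
            (∫⁻ t in Ioc s₁ s₂, ENNReal.ofReal (Real.sinh t ^ (d - 1)))
          ∂(volume : Measure (EuclideanSpace ℝ (Fin d))).toSphere := by
        rw [lintegral_mul_const' _ _ hGs_fin]
    _ ≤ ∫⁻ θ : Metric.sphere (0 : (EuclideanSpace ℝ (Fin d))) 1,
          (∫⁻ t in Ioi (0 : ℝ), (W ∩ C).indicator Jac (t • (θ : (EuclideanSpace ℝ (Fin d)))) *
            ENNReal.ofReal (t ^ (d - 1)) ∂volume) *
            (∫⁻ t in Ico r₁ r₂, ENNReal.ofReal (Real.sinh t ^ (d - 1)))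
          ∂(volume : Measure (EuclideanSpace ℝ (Fin d))).toSphere :=
        lintegral_mono fun θ ↦ hray θ (mem_sphere_zero_iff_norm.1 θ.2)
    _ = (∫⁻ θ : Metric.sphere (0 : (EuclideanSpace ℝ (Fin d))) 1,
          ∫⁻ t in Ioi (0 : ℝ), (W ∩ C).indicator Jac (t • (θ : (EuclideanSpace ℝ (Fin d)))) *
            ENNReal.ofReal (t ^ (d - 1)) ∂volume
            ∂(volume : Measure (EuclideanSpace ℝ (Fin d))).toSphere) *
          (∫⁻ t in Ico r₁ r₂, ENNReal.ofReal (Real.sinh t ^ (d - 1))) := by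
        rw [lintegral_mul_const' _ _ hGr_fin]
    _ = vol (Φ '' (W ∩ C)) * (∫⁻ t in Ico r₁ r₂, ENNReal.ofReal (Real.sinh t ^ (d - 1))) := by
        rw [← hpolar_int C hCm, harea _ (hWm.inter hCm) inter_subset_left]
    _ ≤ _ := mul_le_mul' (measure_mono hsub) le_rfl

end Sector

/-! ### §6. Closed manifolds -/

section Compact

variable {d : ℕ} {M : Type*} [TopologicalSpace M] [ChartedSpace (EuclideanSpace ℝ (Fin d)) M]
  [IsManifold 𝓘(ℝ, EuclideanSpace ℝ (Fin d)) ∞ M] [T2Space M]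
  (g : PseudoRiemannianMetric 𝓘(ℝ, EuclideanSpace ℝ (Fin d)) ∞ (EuclideanSpace ℝ (Fin d))
    (TangentSpace 𝓘(ℝ, EuclideanSpace ℝ (Fin d)) : M → Type _)) [g.HasLeviCivita]

/-- **(A.2.2) on a closed manifold with `Ric ≥ -(d-1)`**: the directionally restricted relative
volume comparison `riemannianMeasure_inter_annulus_mul_le_sector_of_ricci_ge_neg` for compact `M`
and the measure `Vol_g = g.riemVolume` (the Levi-Civita connection of a smooth metric on a compact
manifold being complete). [cite: CheegerColding1997, Appendix 2, (A.2.1)–(A.2.2) (p. 473)] -/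
theorem riemVolume_inter_annulus_mul_le_sector_of_ricci_ge_neg (hd : 0 < d) [ConnectedSpace M]
    [CompactSpace M] [MeasurableSpace M] [BorelSpace M] (hg : g.IsRiemannian)
    (hRic : ∀ (x : M) (w : TangentSpace 𝓘(ℝ, (EuclideanSpace ℝ (Fin d))) x),
      -((d : ℝ) - 1) * g.val x w w ≤ g.ricci x w w)
    (p : M) {U : Set M} (hU : IsOpen U) {s₁ s₂ r₁ r₂ : ℝ} (hs₁ : 0 ≤ s₁) (hs₁₂ : s₁ ≤ s₂)
    (hsr : s₂ ≤ r₁) (hr₁₂ : r₁ ≤ r₂) :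
    g.riemVolume (U ∩ {y : M | ENNReal.ofReal r₁ ≤ g.edist hg p y ∧ g.edist hg p y < ENNReal.ofReal r₂}) *
        ENNReal.ofReal (∫ t in s₁..s₂, Real.sinh t ^ (d - 1)) ≤
      g.riemVolume {x : M | ENNReal.ofReal s₁ < g.edist hg p x ∧ g.edist hg p x ≤ ENNReal.ofReal s₂ ∧
          ∃ z ∈ U, g.edist hg p x + g.edist hg x z = g.edist hg p z} *
        ENNReal.ofReal (∫ t in r₁..r₂, Real.sinh t ^ (d - 1)) := by
  have hk1 : ((1 : ℕ∞) : ℕ∞ω) + 1 ≤ (∞ : ℕ∞ω) := by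
    rw [show ((1 : ℕ∞) : ℕ∞ω) + 1 = 2 by norm_num]
    exact WithTop.coe_le_coe.2 le_top
  haveI : CovariantDerivative.ContMDiffCovariantDerivative g.leviCivita 1 :=
    ⟨g.isLocallyContMDiff_leviCivita_holds 1 hk1 univ isOpen_univ⟩
  haveI : CovariantDerivative.ContMDiffCovariantDerivative g.leviCivita (∞ : ℕ∞ω) :=
    ⟨g.isLocallyContMDiff_leviCivita_holds ⊤ (le_of_eq rfl) univ isOpen_univ⟩
  have hc : IsGeodesicallyComplete g.leviCivita :=
    isGeodesicallyComplete_of_isCompact_closedBall hg (isCompact_setOf_edist_le_of_compactSpace g hg)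
  rw [PseudoRiemannianMetric.riemVolume_eq hg]
  exact riemannianMeasure_inter_annulus_mul_le_sector_of_ricci_ge_neg g hd hg hc
    (fun x w ↦ hRic x w) p hU hs₁ hs₁₂ hsr hr₁₂

/-- **Annular relative volume comparison on a closed manifold with `Ric ≥ -(d-1)`**
(`riemannianMeasure_annulus_mul_le_of_ricci_ge_neg` for compact `M`). [cite: Zhu1997, Thm. 3.1]
[cite: CheegerColding1997, (A.2.2) (p. 473)] -/
theorem riemVolume_annulus_mul_le_of_ricci_ge_neg (hd : 0 < d) [ConnectedSpace M]
    [CompactSpace M] [MeasurableSpace M] [BorelSpace M] (hg : g.IsRiemannian)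
    (hRic : ∀ (x : M) (w : TangentSpace 𝓘(ℝ, (EuclideanSpace ℝ (Fin d))) x),
      -((d : ℝ) - 1) * g.val x w w ≤ g.ricci x w w)
    (p : M) {s₁ s₂ r₁ r₂ : ℝ} (hs₁ : 0 ≤ s₁) (hs₁₂ : s₁ ≤ s₂) (hsr : s₂ ≤ r₁) (hr₁₂ : r₁ ≤ r₂) :
    g.riemVolume {y : M | ENNReal.ofReal r₁ ≤ g.edist hg p y ∧ g.edist hg p y < ENNReal.ofReal r₂} *
        ENNReal.ofReal (∫ t in s₁..s₂, Real.sinh t ^ (d - 1)) ≤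
      g.riemVolume {y : M | ENNReal.ofReal s₁ < g.edist hg p y ∧ g.edist hg p y ≤ ENNReal.ofReal s₂} *
        ENNReal.ofReal (∫ t in r₁..r₂, Real.sinh t ^ (d - 1)) := by
  have hk1 : ((1 : ℕ∞) : ℕ∞ω) + 1 ≤ (∞ : ℕ∞ω) := by
    rw [show ((1 : ℕ∞) : ℕ∞ω) + 1 = 2 by norm_num]
    exact WithTop.coe_le_coe.2 le_top
  haveI : CovariantDerivative.ContMDiffCovariantDerivative g.leviCivita 1 :=
    ⟨g.isLocallyContMDiff_leviCivita_holds 1 hk1 univ isOpen_univ⟩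
  haveI : CovariantDerivative.ContMDiffCovariantDerivative g.leviCivita (∞ : ℕ∞ω) :=
    ⟨g.isLocallyContMDiff_leviCivita_holds ⊤ (le_of_eq rfl) univ isOpen_univ⟩
  have hc : IsGeodesicallyComplete g.leviCivita :=
    isGeodesicallyComplete_of_isCompact_closedBall hg (isCompact_setOf_edist_le_of_compactSpace g hg)
  rw [PseudoRiemannianMetric.riemVolume_eq hg]
  exact riemannianMeasure_annulus_mul_le_of_ricci_ge_neg g hd hg hc (fun x w ↦ hRic x w) p hs₁
    hs₁₂ hsr hr₁₂

end Compact

end Literature.Geometry.Riemannian
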